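import Mathlib
import Summits.NavierStokesRegularity.NavierStokesRegularity.Theorems.EulerZoomLiouvillePowerGaugeEulerLiouvilleCondenserInfiniteType

/-!
# o-FORM OF EVERY WEIGHTED BUDGET: a finite weighted integral `∫ f·‖y‖^a` (`a < 0`) makes the ball integrals `o(L^{−a})` (LEAD 19832 g14, tool)

Class-free tool for crux `EulerZoomLiouville.PowerGaugeEulerLiouville` (stmt-NavierStokesRegularity-19832), LEAD ns-typeII-p2 g14, `--supports … --as helper`.
The general form of (T1) of `…CondenserInfiniteType` (p684185): for a measurable `f : ℝ³ → [0,∞]` and an exponent `a < 0` with `∫⁻ f(y)·‖y‖^a dy < ∞`,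
the normalised ball integrals `L^{a} ∫⁻_{B̄(0,L)} f` tend to `0` (dominated convergence off the origin), i.e. for every `ε > 0`, `∫⁻_{B̄(0,L)} f ≤ ε·L^{−a}` for all large `L`.
USERS (why it is landed as a tool): every TIME-INTEGRATED gauge of Seregin's class turns, for an exactly self-similar member, into such a finite weighted profile integral —
(E): `f = ‖DV‖²`, `a = ρ−1` (`NeedleThinCore.selfSimilar_needle_inputs`.2; this is p684185's (T1)); (D): `f = |P−c₀|^{3/2}`, `a = 2ρ−2` (`profile_pressure_weight_of_gaugeD`) —
so every threshold of the lattice that scales with the O-form constants `C_E`, `C_D` is vacuous (RESIDUE-MEMO-19832-g14 §10; nsreg-p2 R47 v1.2 §7 K∞/K^Σ).  The (A) gauge is a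
SUP gauge and has no o-form.

* `tendsto_setLIntegral_closedBall_mul_rpow_of_weight` — `(n+1)^{a} · ∫⁻_{B̄(0,n)} f → 0` along `n : ℕ`;
* `setLIntegral_closedBall_eventually_le_of_weight` — real radii: `∀ ε > 0, ∃ L₀ ≥ 1, ∀ L ≥ L₀, ∫⁻_{B̄(0,L)} f ≤ ofReal(ε·L^{−a})`;
* `lintegral_pressure_closedBall_eventually_le` — the (D)-instance: `∫⁻ ‖P y − c₀‖ₑ^{3/2}·‖y‖^{2ρ−2} ≤ D`, `ρ < 1` ⇒ `∫⁻_{B̄(0,L)} ‖P−c₀‖ₑ^{3/2} ≤ ε L^{2−2ρ}` eventually.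

WHAT THIS IS NOT: not NS, not E — measure-theoretic bookkeeping on the MODEL lattice; 19832 OPEN; NS regularity NOT proved. [folklore (dominated convergence)]
-/

noncomputable section

open Set Filter Topology Metric Function MeasureTheory Real
open scoped NNReal ENNReal

set_option linter.dupNamespace false

namespace Summit.NavierStokesRegularity.NavierStokesRegularity.Theorems.PowerGaugeEulerLiouville.Condenser

/-- **o-FORM OF A WEIGHTED BUDGET, integer radii.**  `f` measurable, `a < 0`, `∫⁻ f·‖y‖^a ≠ ∞`: `(∫⁻_{B̄(0,n)} f)·(n+1)^{a} → 0`.  Dominated convergence: the integrand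
`1_{B̄(0,n)} f (n+1)^{a}` is dominated by `f·‖y‖^{a}` off the origin (`‖y‖ ≤ n+1`, `a < 0`) and tends to `0` pointwise. [folklore] -/
theorem tendsto_setLIntegral_closedBall_mul_rpow_of_weight {a : ℝ} (ha : a < 0)
    {f : EuclideanSpace ℝ (Fin 3) → ℝ≥0∞} (hf : Measurable f) (hfin : ∀ y, f y ≠ ∞)
    (hW : ∫⁻ y, f y * ENNReal.ofReal (‖y‖ ^ a) ≠ ∞) :
    Tendsto (fun n : ℕ => (∫⁻ z in closedBall (0 : EuclideanSpace ℝ (Fin 3)) n, f z) *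
      ENNReal.ofReal (((n : ℝ) + 1) ^ a)) atTop (𝓝 0) := by
  set F : ℕ → EuclideanSpace ℝ (Fin 3) → ℝ≥0∞ := fun n z =>
    (closedBall (0 : EuclideanSpace ℝ (Fin 3)) n).indicator (fun z => f z * ENNReal.ofReal (((n : ℝ) + 1) ^ a)) z with hF
  set bound : EuclideanSpace ℝ (Fin 3) → ℝ≥0∞ := fun y => f y * ENNReal.ofReal (‖y‖ ^ a) with hbound
  have hF_meas : ∀ n, Measurable (F n) := fun n =>
    (hf.mul measurable_const).indicator measurableSet_closedBall
  have h_bound : ∀ n, F n ≤ᵐ[volume] bound := by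
    intro n
    have h0 : ({0}ᶜ : Set (EuclideanSpace ℝ (Fin 3))) ∈ ae (volume : Measure (EuclideanSpace ℝ (Fin 3))) :=
      compl_mem_ae_iff.2 (measure_singleton 0)
    filter_upwards [h0] with z hz
    simp only [hF, hbound]
    by_cases hzn : z ∈ closedBall (0 : EuclideanSpace ℝ (Fin 3)) n
    · rw [indicator_of_mem hzn]
      have hz0 : 0 < ‖z‖ := norm_pos_iff.2 hz
      have hzn' : ‖z‖ ≤ (n : ℝ) + 1 := (mem_closedBall_zero_iff.1 hzn).trans (by linarith)
      have h1 : ((n : ℝ) + 1) ^ a ≤ ‖z‖ ^ a := Real.rpow_le_rpow_of_nonpos hz0 hzn' ha.le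
      exact mul_le_mul' le_rfl (ENNReal.ofReal_le_ofReal h1)
    · rw [indicator_of_notMem hzn]
      exact zero_le
  have h_lim : ∀ᵐ z ∂(volume : Measure (EuclideanSpace ℝ (Fin 3))), Tendsto (fun n => F n z) atTop (𝓝 0) := by
    refine Filter.Eventually.of_forall fun z => ?_
    have hpow : Tendsto (fun n : ℕ => ((n : ℝ) + 1) ^ a) atTop (𝓝 0) := by
      have h1 : Tendsto (fun x : ℝ => x ^ (-(-a))) atTop (𝓝 0) := tendsto_rpow_neg_atTop (by linarith)
      have h2 : Tendsto (fun n : ℕ => (n : ℝ) + 1) atTop atTop :=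
        tendsto_atTop_add_const_right _ _ tendsto_natCast_atTop_atTop
      refine (h1.comp h2).congr fun n => ?_
      simp only [Function.comp_apply, neg_neg]
    have hof : Tendsto (fun n : ℕ => ENNReal.ofReal (((n : ℝ) + 1) ^ a)) atTop (𝓝 0) := by
      simpa using ENNReal.tendsto_ofReal hpow
    have hmul : Tendsto (fun n : ℕ => f z * ENNReal.ofReal (((n : ℝ) + 1) ^ a)) atTop (𝓝 0) := by
      simpa using ENNReal.Tendsto.const_mul hof (Or.inr (hfin z))
    refine tendsto_of_tendsto_of_tendsto_of_le_of_le tendsto_const_nhds hmul (fun n => zero_le) fun n => ?_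
    simp only [hF]
    by_cases hzn : z ∈ closedBall (0 : EuclideanSpace ℝ (Fin 3)) n
    · rw [indicator_of_mem hzn]
    · rw [indicator_of_notMem hzn]
      exact zero_le
  have hconv := tendsto_lintegral_of_dominated_convergence bound hF_meas h_bound hW h_lim
  simp only [lintegral_zero] at hconv
  refine hconv.congr fun n => ?_
  rw [hF, lintegral_indicator measurableSet_closedBall, lintegral_mul_const _ hf]

/-- **o-FORM OF A WEIGHTED BUDGET (real radii).**  `f` measurable and finite-valued, `a < 0`, `∫⁻ f·‖y‖^a ≠ ∞`: for every `ε > 0` there is `L₀ ≥ 1` with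
`∫⁻_{B̄(0,L)} f ≤ ofReal(ε·L^{−a})` for all `L ≥ L₀`. [folklore] -/
theorem setLIntegral_closedBall_eventually_le_of_weight {a : ℝ} (ha : a < 0)
    {f : EuclideanSpace ℝ (Fin 3) → ℝ≥0∞} (hf : Measurable f) (hfin : ∀ y, f y ≠ ∞)
    (hW : ∫⁻ y, f y * ENNReal.ofReal (‖y‖ ^ a) ≠ ∞) {ε : ℝ} (hε : 0 < ε) :
    ∃ L₀ : ℝ, 1 ≤ L₀ ∧ ∀ L : ℝ, L₀ ≤ L →
      ∫⁻ z in closedBall (0 : EuclideanSpace ℝ (Fin 3)) L, f z ≤ ENNReal.ofReal (ε * L ^ (-a)) := by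
  have h3 : 0 < (3 : ℝ) ^ (-a) := Real.rpow_pos_of_pos (by norm_num) _
  set ε' : ℝ := ε / (3 : ℝ) ^ (-a) with hε'
  have hε'pos : 0 < ε' := div_pos hε h3
  have ht := tendsto_setLIntegral_closedBall_mul_rpow_of_weight ha hf hfin hW
  rw [ENNReal.tendsto_nhds_zero] at ht
  obtain ⟨N, hN⟩ := eventually_atTop.1 (ht (ENNReal.ofReal ε') (by simpa using hε'pos))
  refine ⟨max (N : ℝ) 1, le_max_right _ _, fun L hL => ?_⟩
  have hL1 : 1 ≤ L := (le_max_right _ _).trans hL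
  have hLN : (N : ℝ) ≤ L := (le_max_left _ _).trans hL
  have hL0 : 0 < L := by linarith
  set n : ℕ := ⌈L⌉₊ with hn
  have hLn : L ≤ (n : ℝ) := Nat.le_ceil L
  have hnL : (n : ℝ) < L + 1 := Nat.ceil_lt_add_one hL0.le
  have hNn : N ≤ n := by
    have : (N : ℝ) ≤ (n : ℝ) := hLN.trans hLn
    exact_mod_cast this
  have hI := hN n hNn
  set b : ℝ := ((n : ℝ) + 1) ^ a with hb
  have hn1 : (0 : ℝ) < (n : ℝ) + 1 := by positivity
  have hbpos : 0 < b := Real.rpow_pos_of_pos hn1 _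
  have hbinv : b⁻¹ = ((n : ℝ) + 1) ^ (-a) := by rw [hb, ← Real.rpow_neg hn1.le]
  have hI' : ∫⁻ z in closedBall (0 : EuclideanSpace ℝ (Fin 3)) n, f z ≤ ENNReal.ofReal (ε' * ((n : ℝ) + 1) ^ (-a)) := by
    have h1 : (∫⁻ z in closedBall (0 : EuclideanSpace ℝ (Fin 3)) n, f z) =
        (∫⁻ z in closedBall (0 : EuclideanSpace ℝ (Fin 3)) n, f z) * ENNReal.ofReal b * ENNReal.ofReal b⁻¹ := by
      rw [mul_assoc, ← ENNReal.ofReal_mul hbpos.le, mul_inv_cancel₀ hbpos.ne', ENNReal.ofReal_one, mul_one]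
    rw [h1, ← hbinv, ENNReal.ofReal_mul hε'pos.le]
    exact mul_le_mul' hI le_rfl
  have hsub : closedBall (0 : EuclideanSpace ℝ (Fin 3)) L ⊆ closedBall 0 n := closedBall_subset_closedBall hLn
  refine (lintegral_mono_set hsub).trans (hI'.trans (ENNReal.ofReal_le_ofReal ?_))
  have h2 : ((n : ℝ) + 1) ^ (-a) ≤ (3 * L) ^ (-a) := Real.rpow_le_rpow hn1.le (by linarith) (by linarith)
  have h3L : (3 * L) ^ (-a) = (3 : ℝ) ^ (-a) * L ^ (-a) := Real.mul_rpow (by norm_num) hL0.le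
  calc ε' * ((n : ℝ) + 1) ^ (-a) ≤ ε' * (3 * L) ^ (-a) := mul_le_mul_of_nonneg_left h2 hε'pos.le
    _ = ε * L ^ (-a) := by rw [h3L, hε']; field_simp

/-- **o-FORM OF THE (D)-BUDGET (pressure).**  `P` measurable, `ρ < 1`, `∫⁻ ‖P y − c₀‖ₑ^{3/2}·‖y‖^{2ρ−2} ≠ ∞` (the class's weighted pressure integral of an exactly
self-similar member, `profile_pressure_weight_of_gaugeD`): for every `ε > 0`, `∫⁻_{B̄(0,L)} ‖P−c₀‖ₑ^{3/2} ≤ ε·L^{2−2ρ}` for all large `L` — the O-form constant `C_D` is moot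
exactly like `C_E`. [folklore] -/
theorem lintegral_pressure_closedBall_eventually_le {ρ : ℝ} (hρ1 : ρ < 1)
    {P : EuclideanSpace ℝ (Fin 3) → ℝ} (hP : Measurable P) (c₀ : ℝ)
    (hD : ∫⁻ y, ‖P y - c₀‖ₑ ^ (3 / 2 : ℝ) * ENNReal.ofReal (‖y‖ ^ (2 * ρ - 2)) ≠ ∞) {ε : ℝ} (hε : 0 < ε) :
    ∃ L₀ : ℝ, 1 ≤ L₀ ∧ ∀ L : ℝ, L₀ ≤ L →
      ∫⁻ z in closedBall (0 : EuclideanSpace ℝ (Fin 3)) L, ‖P z - c₀‖ₑ ^ (3 / 2 : ℝ) ≤ ENNReal.ofReal (ε * L ^ (2 - 2 * ρ)) := by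
  have ha : 2 * ρ - 2 < 0 := by linarith
  have hf : Measurable fun z : EuclideanSpace ℝ (Fin 3) => ‖P z - c₀‖ₑ ^ (3 / 2 : ℝ) :=
    (hP.sub measurable_const).enorm.pow_const _
  have hfin : ∀ y : EuclideanSpace ℝ (Fin 3), ‖P y - c₀‖ₑ ^ (3 / 2 : ℝ) ≠ ∞ := fun y =>
    ENNReal.rpow_ne_top_of_nonneg (by norm_num) (by simp)
  obtain ⟨L₀, hL₀, h⟩ := setLIntegral_closedBall_eventually_le_of_weight ha hf hfin hD hε
  refine ⟨L₀, hL₀, fun L hL => (h L hL).trans (le_of_eq ?_)⟩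
  rw [show -(2 * ρ - 2) = 2 - 2 * ρ by ring]

end Summit.NavierStokesRegularity.NavierStokesRegularity.Theorems.PowerGaugeEulerLiouville.Condenser

end
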